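import Summits.QuantumFields.YangMills.Theses.RevelationMartingale

/-!
# Route RevelationMartingale — the pure-probability engine `PredictableHoeffding` (stmt-QuantumFields-23084), proved

Azuma–Hoeffding with a PREDICTABLE variance proxy (Stout's exponential supermartingale, event form):
on a probability space with a filtration `ℱ` (`ℱ 0 = ⊥`), a bounded `ℱ n`-measurable `f`, adapted `σ i ≥ 0` with
`E[exp (s·D_i) | ℱ i] ≤ exp (s²·σ i / 2)` a.s. for every real `s` (`D_i = E[f | ℱ (i+1)] − E[f | ℱ i]`), one has
`μ {t ≤ f − E f ∧ Σ_{i<n} σ i ≤ v} ≤ exp (−t²/(2v))` for `v > 0`, `t ≥ 0`.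

Proof.  With `l = t/v ≥ 0` put `Z k = exp (l·(E[f|ℱ k] − E[f|ℱ 0]) − (l²/2)·Σ_{i<k} σ i)`.  The pull-out property
and the hypothesis at `s = l` give `E[Z (k+1) | ℱ k] ≤ Z k` a.s., hence `∫ Z n ≤ ∫ Z 0 = 1`; on the event,
`Z n ≥ exp (t²/(2v))` because `E[f|ℱ n] = f` and `E[f|ℱ 0] = E f`; Markov's inequality concludes.  Mathlib only; no
summit, rung or crux is proved here (this is the route's textbook support item).
[cite: book:de-la-pena2009-self-normalized-processes, Thm 9.18-9.21 pp.102-104] [folklore]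
-/

namespace Summit.QuantumFields.YangMills.Theorems

open scoped BigOperators Topology Classical MeasureTheory
open Filter Set Function MeasureTheory

/-- **Azuma–Hoeffding with a predictable variance proxy** (Stout's exponential supermartingale), the support item
`PredictableHoeffding` of route `RevelationMartingale`, BY NAME. [folklore] -/
theorem revelationMartingale_predictableHoeffding_proof :
    Summit.QuantumFields.YangMills.Theses.RevelationMartingale.PredictableHoeffding := by
  intro Ω mΩ μ hμ ℱ f σ n B v t hv ht hfB h0 hfn hσm hσ0 hmgf
  -- the Doob martingale `E[f | ℱ k]`: measurability, boundedness, end points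
  have hf_meas : StronglyMeasurable f := hfn.mono (ℱ.le n)
  have hfB' : ∀ᵐ ω ∂μ, |f ω| ≤ B := Eventually.of_forall hfB
  have hf_int : Integrable f μ :=
    Integrable.of_bound hf_meas.aestronglyMeasurable B
      (Eventually.of_forall fun ω => by rw [Real.norm_eq_abs]; exact hfB ω)
  have hMn : μ[f|ℱ n] = f := condExp_of_stronglyMeasurable (ℱ.le n) hfn hf_int
  have hM0 : μ[f|ℱ 0] = fun _ => ∫ x, f x ∂μ := by rw [h0]; exact condExp_bot f
  have hM_bdd : ∀ k, ∀ᵐ ω ∂μ, |(μ[f|ℱ k]) ω| ≤ B := fun k =>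
    ae_bdd_abs_condExp_of_ae_bdd_abs hfB'
  have hM_sm : ∀ k, StronglyMeasurable[ℱ k] (μ[f|ℱ k]) := fun k => stronglyMeasurable_condExp
  -- the tilt parameter
  obtain ⟨l, hl⟩ : ∃ l : ℝ, l = t / v := ⟨_, rfl⟩
  have hl0 : 0 ≤ l := by rw [hl]; exact div_nonneg ht hv.le
  -- the predictable variation `V k = Σ_{i<k} σ i`
  have hV0 : ∀ k ω, 0 ≤ ∑ i ∈ Finset.range k, σ i ω := fun k ω =>
    Finset.sum_nonneg fun i _ => hσ0 i ω
  have hV_sm : ∀ k, StronglyMeasurable[ℱ k] (fun ω => ∑ i ∈ Finset.range k, σ i ω) := fun k =>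
    Finset.stronglyMeasurable_fun_sum (Finset.range k)
      (fun i hi => (hσm i).mono (ℱ.mono (Finset.mem_range.mp hi).le))
  -- Stout's process `Z k = exp (l (E[f|ℱ k] - E[f|ℱ 0]) - (l²/2) V k)`
  obtain ⟨Z, hZ⟩ : ∃ Z : ℕ → Ω → ℝ, ∀ k, Z k = fun ω =>
      Real.exp (l * ((μ[f|ℱ k]) ω - (μ[f|ℱ 0]) ω) - l ^ 2 / 2 * ∑ i ∈ Finset.range k, σ i ω) :=
    ⟨_, fun _ => rfl⟩
  have hZ_pos : ∀ k ω, 0 < Z k ω := fun k ω => by rw [hZ]; exact Real.exp_pos _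
  have hZ_sm : ∀ k, StronglyMeasurable[ℱ k] (Z k) := fun k => by
    rw [hZ]
    exact Real.continuous_exp.comp_stronglyMeasurable
      ((((hM_sm k).sub ((hM_sm 0).mono (ℱ.mono (Nat.zero_le k)))).const_mul l).sub
        ((hV_sm k).const_mul (l ^ 2 / 2)))
  have hZ_bdd : ∀ k, ∀ᵐ ω ∂μ, ‖Z k ω‖ ≤ Real.exp (2 * l * B) := fun k => by
    filter_upwards [hM_bdd k, hM_bdd 0] with ω hk hk0
    rw [Real.norm_eq_abs, abs_of_pos (hZ_pos k ω), hZ]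
    refine Real.exp_le_exp.mpr ?_
    have h1 : (μ[f|ℱ k]) ω - (μ[f|ℱ 0]) ω ≤ 2 * B := by
      have e1 := (abs_le.mp hk).2
      have e2 := (abs_le.mp hk0).1
      linarith
    have h2 : l * ((μ[f|ℱ k]) ω - (μ[f|ℱ 0]) ω) ≤ l * (2 * B) := mul_le_mul_of_nonneg_left h1 hl0
    have h3 : 0 ≤ l ^ 2 / 2 * ∑ i ∈ Finset.range k, σ i ω := mul_nonneg (by positivity) (hV0 k ω)
    linarith
  have hZ_int : ∀ k, Integrable (Z k) μ := fun k =>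
    Integrable.of_bound ((hZ_sm k).mono (ℱ.le k)).aestronglyMeasurable _ (hZ_bdd k)
  -- the supermartingale step, integrated: `∫ Z (k+1) ≤ ∫ Z k`
  have hstep : ∀ k, ∫ ω, Z (k + 1) ω ∂μ ≤ ∫ ω, Z k ω ∂μ := fun k => by
    -- `Z (k+1) = g * h` with `g` `ℱ k`-measurable and `h = exp (l D_k)`
    have hg_sm : StronglyMeasurable[ℱ k] (fun ω => Z k ω * Real.exp (-(l ^ 2 / 2) * σ k ω)) :=
      (hZ_sm k).mul (Real.continuous_exp.comp_stronglyMeasurable ((hσm k).const_mul (-(l ^ 2 / 2))))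
    have hg_nonneg : ∀ ω, 0 ≤ Z k ω * Real.exp (-(l ^ 2 / 2) * σ k ω) := fun ω =>
      mul_nonneg (hZ_pos k ω).le (Real.exp_pos _).le
    have hg_bdd : ∀ᵐ ω ∂μ, ‖Z k ω * Real.exp (-(l ^ 2 / 2) * σ k ω)‖ ≤ Real.exp (2 * l * B) := by
      filter_upwards [hZ_bdd k] with ω hω
      rw [Real.norm_eq_abs, abs_of_nonneg (hg_nonneg ω)]
      rw [Real.norm_eq_abs, abs_of_pos (hZ_pos k ω)] at hω
      have h1 : Real.exp (-(l ^ 2 / 2) * σ k ω) ≤ 1 := by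
        refine Real.exp_le_one_iff.mpr ?_
        have := hσ0 k ω
        nlinarith [sq_nonneg l]
      calc Z k ω * Real.exp (-(l ^ 2 / 2) * σ k ω) ≤ Z k ω * 1 :=
            mul_le_mul_of_nonneg_left h1 (hZ_pos k ω).le
        _ ≤ Real.exp (2 * l * B) := by rw [mul_one]; exact hω
    have hh_sm : StronglyMeasurable
        (fun ω' => Real.exp (l * ((μ[f|ℱ (k + 1)]) ω' - (μ[f|ℱ k]) ω'))) :=
      Real.continuous_exp.comp_stronglyMeasurable
        ((((hM_sm (k + 1)).mono (ℱ.le (k + 1))).sub ((hM_sm k).mono (ℱ.le k))).const_mul l)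
    have hh_int : Integrable (fun ω' => Real.exp (l * ((μ[f|ℱ (k + 1)]) ω' - (μ[f|ℱ k]) ω'))) μ := by
      refine Integrable.of_bound hh_sm.aestronglyMeasurable (Real.exp (2 * l * B)) ?_
      filter_upwards [hM_bdd (k + 1), hM_bdd k] with ω hk1 hk
      rw [Real.norm_eq_abs, abs_of_pos (Real.exp_pos _)]
      refine Real.exp_le_exp.mpr ?_
      have h1 : (μ[f|ℱ (k + 1)]) ω - (μ[f|ℱ k]) ω ≤ 2 * B := by
        have e1 := (abs_le.mp hk1).2
        have e2 := (abs_le.mp hk).1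
        linarith
      have h2 := mul_le_mul_of_nonneg_left h1 hl0
      linarith
    have hfac : Z (k + 1) = (fun ω => Z k ω * Real.exp (-(l ^ 2 / 2) * σ k ω)) *
        (fun ω' => Real.exp (l * ((μ[f|ℱ (k + 1)]) ω' - (μ[f|ℱ k]) ω'))) := by
      funext ω
      simp only [hZ, Pi.mul_apply, Finset.sum_range_succ]
      rw [← Real.exp_add, ← Real.exp_add]
      congr 1
      ring
    have hpull := condExp_stronglyMeasurable_mul_of_bound (ℱ.le k) hg_sm hh_int (Real.exp (2 * l * B)) hg_bdd
    have hce : μ[Z (k + 1)|ℱ k] ≤ᵐ[μ] Z k := by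
      rw [hfac]
      filter_upwards [hpull, hmgf k l] with ω hω hmg
      rw [hω, Pi.mul_apply]
      calc Z k ω * Real.exp (-(l ^ 2 / 2) * σ k ω) *
              (μ[fun ω' => Real.exp (l * ((μ[f|ℱ (k + 1)]) ω' - (μ[f|ℱ k]) ω'))|ℱ k]) ω
            ≤ Z k ω * Real.exp (-(l ^ 2 / 2) * σ k ω) * Real.exp (l ^ 2 * σ k ω / 2) :=
              mul_le_mul_of_nonneg_left hmg (hg_nonneg ω)
        _ = Z k ω := by
              rw [mul_assoc, ← Real.exp_add]
              have : -(l ^ 2 / 2) * σ k ω + l ^ 2 * σ k ω / 2 = 0 := by ring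
              rw [this, Real.exp_zero, mul_one]
    calc ∫ ω, Z (k + 1) ω ∂μ = ∫ ω, (μ[Z (k + 1)|ℱ k]) ω ∂μ := (integral_condExp (ℱ.le k)).symm
      _ ≤ ∫ ω, Z k ω ∂μ := integral_mono_ae integrable_condExp (hZ_int k) hce
  -- `∫ Z 0 = 1`, hence `∫ Z n ≤ 1`
  have hZ0 : ∫ ω, Z 0 ω ∂μ = 1 := by
    have : Z 0 = fun _ => (1 : ℝ) := by
      funext ω
      simp only [hZ, sub_self, mul_zero, Finset.sum_range_zero, Real.exp_zero]
    rw [this, integral_const, smul_eq_mul, mul_one, probReal_univ]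
  have hZle : ∀ k, ∫ ω, Z k ω ∂μ ≤ 1 := by
    intro k
    induction k with
    | zero => exact hZ0.le
    | succ k ih => exact (hstep k).trans ih
  -- on the event, `Z n ≥ exp (t²/(2v))`
  have hlow : ∀ ω ∈ {ω | t ≤ f ω - ∫ x, f x ∂μ ∧ ∑ i ∈ Finset.range n, σ i ω ≤ v},
      Real.exp (t ^ 2 / (2 * v)) ≤ Z n ω := by
    rintro ω ⟨h1, h2⟩
    simp only [hZ, hMn, hM0]
    refine Real.exp_le_exp.mpr ?_
    have e1 : l * t ≤ l * (f ω - ∫ x, f x ∂μ) := mul_le_mul_of_nonneg_left h1 hl0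
    have e2 : l ^ 2 / 2 * ∑ i ∈ Finset.range n, σ i ω ≤ l ^ 2 / 2 * v :=
      mul_le_mul_of_nonneg_left h2 (by positivity)
    have e3 : l * t - l ^ 2 / 2 * v = t ^ 2 / (2 * v) := by
      rw [hl]; field_simp; ring
    linarith
  -- the event is measurable
  have hA : MeasurableSet {ω | t ≤ f ω - ∫ x, f x ∂μ ∧ ∑ i ∈ Finset.range n, σ i ω ≤ v} := by
    rw [Set.setOf_and]
    exact (measurableSet_le measurable_const (hf_meas.measurable.sub measurable_const)).inter
      (measurableSet_le ((hV_sm n).mono (ℱ.le n)).measurable measurable_const)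
  -- Markov
  have key : Real.exp (t ^ 2 / (2 * v)) *
      μ.real {ω | t ≤ f ω - ∫ x, f x ∂μ ∧ ∑ i ∈ Finset.range n, σ i ω ≤ v} ≤ 1 := by
    calc Real.exp (t ^ 2 / (2 * v)) * μ.real {ω | t ≤ f ω - ∫ x, f x ∂μ ∧ ∑ i ∈ Finset.range n, σ i ω ≤ v}
          = ∫ ω in {ω | t ≤ f ω - ∫ x, f x ∂μ ∧ ∑ i ∈ Finset.range n, σ i ω ≤ v},
              Real.exp (t ^ 2 / (2 * v)) ∂μ := by
            rw [setIntegral_const, smul_eq_mul, mul_comm]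
      _ ≤ ∫ ω in {ω | t ≤ f ω - ∫ x, f x ∂μ ∧ ∑ i ∈ Finset.range n, σ i ω ≤ v}, Z n ω ∂μ :=
            setIntegral_mono_on (integrable_const _).integrableOn (hZ_int n).integrableOn hA hlow
      _ ≤ ∫ ω, Z n ω ∂μ := setIntegral_le_integral (hZ_int n) (Eventually.of_forall fun ω => (hZ_pos n ω).le)
      _ ≤ 1 := hZle n
  have hexp : 0 < Real.exp (t ^ 2 / (2 * v)) := Real.exp_pos _
  rw [Real.exp_neg, inv_eq_one_div, le_div_iff₀ hexp, mul_comm]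
  exact key

end Summit.QuantumFields.YangMills.Theorems
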